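import Literature.AnabelianGeometry.EtaleTheta.SettingModelChiCyclotomicPackage
import HarnessLib

/-!
# [EtTh] §1 p. 238 «`(Δ^tp_Y)^ell ≅ Ẑ(1)`»: INSTANCE FORMS of `DeltaYEllIsoTate` (F-0659) and
# `DeltaYEllClosureIsoTate` (F-1697) — head-form, hypothesis-free, at the χ-bridge origin of record

S. Mochizuki, *The étale theta function and its Frobenioid-theoretic manifestations*, Publ. RIMS **45** (2009)
[EtTh], §1, printed p. 238 (PRIMS PDF p. 12): «Then we have a natural exact sequence `1 → Ẑ(1) → Δ^ell_X → Ẑ → 1` …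
Thus, `(Δ^tp_Y)^ell ≅ Ẑ(1)`» [cite: MochizukiEtTh2009, §1 p.238]; p. 13 (`G_K` acts on `μ_N` through the cyclotomic
character).

abc-iut cell, block F (instance-form batch INST59J2), seat abc-iut-f-110 (gen 6).  FACT-LIST rows **F-0659**
`Literature.AnabelianGeometry.SemiGraphs.OncePuncturedTemperedGroup.DeltaYEllIsoTate` and **F-1697**
`Literature.AnabelianGeometry.SemiGraphs.OncePuncturedTemperedGroup.DeltaYEllClosureIsoTate` (trunk
`SemiGraphs/TemperedCyclotomic.lean`, abc-iut-L3): predicates `∀ D, Ω.IsTateOrigin D → IsTateTwist …` on the origin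
binder `Ω : TemperedPiOrigin K`.  Their universal closures over the lawless binder are REFUTED
(abc-iut-w6-d060, `TemperedCyclotomicClosures.lean`: `not_forall_deltaYEllIsoTate`, `not_forall_deltaYEllClosureIsoTate`,
at a `ℚ₃`-datum with inner `Π^tp_X`-action), so the rows are consumed AT NAMED INSTANCES (cell rule R5).  The kernel
census (LF-KERNEL-STATUS col. 14) listed for both rows only conditional closers (`…_of_deltaThetaIsoTate`, …) and the
`∃`-packaged witness of abc-iut-L2-t7 (`SettingModel.exists_inhabited_origin_cyclotomicPackage_chi`), but NO theorem whose
conclusion HEAD is the row's declaration.  This PROOF-ONLY file (0 `def`, 0 `instance`, no new `Prop`, nothing restated;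
every input BY NAME) supplies exactly those head forms, at the carrier WITH ARITHMETIC CONTENT already in the tree:

* the **χ-bridge origin** `Ω_χ(p)` over `K₀ = ℚ_p` — «`D` IS the bridge datum
  `(ThetaSetting.modelχ′ p).toOncePuncturedTemperedGroup e` of abc-iut-L2-t7's file 2a (`SettingModelChiEllLevels`)
  for THE parameter bundle `e` with the canonical Galois identification» (`e :=` the witness of
  `SettingModel.exists_oncePuncturedData_galEquiv_eq p`, extracted by `Classical.choose`; the origin binder is written as
  a structure literal, so no definition is introduced).  The binder is INHABITED by construction
  (`isTateOrigin_chiBridgeOrigin`), and at it `G_{ℚ_p}` acts on the roots of unity through a NON-TRIVIAL cyclotomic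
  character (abc-iut-L2-t7's `exists_chi_right_ne_one`) — so these instances are not the Galois-trivial / vacuous ones.
* `deltaYEllClosureIsoTate_chiBridgeOrigin p` — **F-1697 head form** for every prime `p` (abc-iut-L2-t7's
  `deltaYEllClosureIsoTate_body_bridgeχ'` BY NAME);
* `deltaYEllIsoTate_chiBridgeOrigin p` — **F-0659 head form** for every prime `p` (from F-1697 by abc-iut-f-172's
  `OncePuncturedCyclotomic.cyclotomicPackage_of_deltaYEllClosureIsoTate`);
* `deltaYEllClosureIsoTate_chiBridgeOrigin_three`, `deltaYEllIsoTate_chiBridgeOrigin_three` — the CLOSED instances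
  (0 binders) at `p = 3`.

HONEST LABEL: `modelχ′` is abc-iut-L2's SEMI-SYNTHETIC χ-twisted model (consistency evidence with arithmetic content
for OUR typed predicates), NOT the tempered fundamental group of a once-punctured elliptic curve (not constructed in the
tree, FOUNDATIONS row 13); an instance-form theorem about OUR typed statement ≠ a theorem about [EtTh] in print; the
universal closures stay refuted; nothing here bears on, or takes a side on, [IUTchIII] Cor. 3.12; typed ≠ proved.
-/

noncomputable section

namespace Literature.AnabelianGeometry.SemiGraphs

namespace OncePuncturedTemperedGroup

open Literature.AnabelianGeometry.EtaleTheta Literature.AnabelianGeometry.EtaleTheta.SettingModel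

variable (p : ℕ) [Fact p.Prime]

/-- **The χ-bridge origin binder is inhabited**: the bridge datum of `modelχ′ p` at THE canonical parameter bundle is a
Tate-origin datum of `Ω_χ(p)` (by `rfl`) — recorded so that the instances below are visibly non-vacuous.
[cite: MochizukiEtTh2009, §1 p.238] -/
theorem isTateOrigin_chiBridgeOrigin :
    ({ IsOfGeometricOrigin := fun _ => True
       IsTateOrigin := fun D => D = (ThetaSetting.modelχ' p).toOncePuncturedTemperedGroup
         (Classical.choose (exists_oncePuncturedData_galEquiv_eq p))
       isOfGeometricOrigin_of_isTateOrigin := fun _ _ => trivial } : TemperedPiOrigin ↥(curveχ' p).K).IsTateOrigin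
      ((ThetaSetting.modelχ' p).toOncePuncturedTemperedGroup
        (Classical.choose (exists_oncePuncturedData_galEquiv_eq p))) :=
  rfl

/-- **F-1697 `DeltaYEllClosureIsoTate`, INSTANCE FORM at the χ-bridge origin `Ω_χ(p)`** (every prime `p`): inside
`Δ^ell_X` of the (unique) origin datum, the closure of the image of `Δ^tp_Y` is a closed `Π^tp_X`-stable Tate twist
`Ẑ(1)` — abc-iut-L2-t7's `deltaYEllClosureIsoTate_body_bridgeχ'` at THE canonical bundle (`Classical.choose_spec`).
INSTANCE at the semi-synthetic χ-model of record (honest label in the module docstring).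
[cite: MochizukiEtTh2009, §1 p.238] -/
theorem deltaYEllClosureIsoTate_chiBridgeOrigin :
    Literature.AnabelianGeometry.SemiGraphs.OncePuncturedTemperedGroup.DeltaYEllClosureIsoTate
      ({ IsOfGeometricOrigin := fun _ => True
         IsTateOrigin := fun D => D = (ThetaSetting.modelχ' p).toOncePuncturedTemperedGroup
           (Classical.choose (exists_oncePuncturedData_galEquiv_eq p))
         isOfGeometricOrigin_of_isTateOrigin := fun _ _ => trivial } : TemperedPiOrigin ↥(curveχ' p).K) := by
  intro D hD
  change D = (ThetaSetting.modelχ' p).toOncePuncturedTemperedGroup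
    (Classical.choose (exists_oncePuncturedData_galEquiv_eq p)) at hD
  subst hD
  exact deltaYEllClosureIsoTate_body_bridgeχ' p _ (Classical.choose_spec (exists_oncePuncturedData_galEquiv_eq p))

/-- **F-0659 `DeltaYEllIsoTate`, INSTANCE FORM at the χ-bridge origin `Ω_χ(p)`** (every prime `p`): the tempered
quotient `(Δ^tp_Y)^ell ⊆ (Π^tp_X)^ell` of the origin datum, with the conjugation action of `Π^tp_X`, is a Tate twist
`Ẑ(1)` — from the F-1697 instance by abc-iut-f-172's `OncePuncturedCyclotomic.cyclotomicPackage_of_deltaYEllClosureIsoTate`.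
INSTANCE at the semi-synthetic χ-model of record. [cite: MochizukiEtTh2009, §1 p.238] -/
theorem deltaYEllIsoTate_chiBridgeOrigin :
    Literature.AnabelianGeometry.SemiGraphs.OncePuncturedTemperedGroup.DeltaYEllIsoTate
      ({ IsOfGeometricOrigin := fun _ => True
         IsTateOrigin := fun D => D = (ThetaSetting.modelχ' p).toOncePuncturedTemperedGroup
           (Classical.choose (exists_oncePuncturedData_galEquiv_eq p))
         isOfGeometricOrigin_of_isTateOrigin := fun _ _ => trivial } : TemperedPiOrigin ↥(curveχ' p).K) :=
  (OncePuncturedCyclotomic.cyclotomicPackage_of_deltaYEllClosureIsoTate _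
    (deltaYEllClosureIsoTate_chiBridgeOrigin p)).2.2

/-- The companions F-0657 `DeltaEllExtension` and F-0658 `DeltaThetaIsoTate` at the same origin (head forms, for the
record; same source lemma). [cite: MochizukiEtTh2009, §1 p.238] -/
theorem deltaEllExtension_and_deltaThetaIsoTate_chiBridgeOrigin :
    Literature.AnabelianGeometry.SemiGraphs.OncePuncturedTemperedGroup.DeltaEllExtension
      ({ IsOfGeometricOrigin := fun _ => True
         IsTateOrigin := fun D => D = (ThetaSetting.modelχ' p).toOncePuncturedTemperedGroup
           (Classical.choose (exists_oncePuncturedData_galEquiv_eq p))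
         isOfGeometricOrigin_of_isTateOrigin := fun _ _ => trivial } : TemperedPiOrigin ↥(curveχ' p).K) ∧
    Literature.AnabelianGeometry.SemiGraphs.OncePuncturedTemperedGroup.DeltaThetaIsoTate
      ({ IsOfGeometricOrigin := fun _ => True
         IsTateOrigin := fun D => D = (ThetaSetting.modelχ' p).toOncePuncturedTemperedGroup
           (Classical.choose (exists_oncePuncturedData_galEquiv_eq p))
         isOfGeometricOrigin_of_isTateOrigin := fun _ _ => trivial } : TemperedPiOrigin ↥(curveχ' p).K) :=
  let h := OncePuncturedCyclotomic.cyclotomicPackage_of_deltaYEllClosureIsoTate _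
    (deltaYEllClosureIsoTate_chiBridgeOrigin p)
  ⟨h.1, h.2.1⟩

/-- **F-1697, CLOSED INSTANCE (0 binders) at `p = 3`**: `DeltaYEllClosureIsoTate (Ω_χ(3))` over `K₀ = ℚ₃`.
[cite: MochizukiEtTh2009, §1 p.238] -/
theorem deltaYEllClosureIsoTate_chiBridgeOrigin_three :
    Literature.AnabelianGeometry.SemiGraphs.OncePuncturedTemperedGroup.DeltaYEllClosureIsoTate
      ({ IsOfGeometricOrigin := fun _ => True
         IsTateOrigin := fun D => D = (ThetaSetting.modelχ' 3).toOncePuncturedTemperedGroup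
           (Classical.choose (exists_oncePuncturedData_galEquiv_eq 3))
         isOfGeometricOrigin_of_isTateOrigin := fun _ _ => trivial } : TemperedPiOrigin ↥(curveχ' 3).K) :=
  deltaYEllClosureIsoTate_chiBridgeOrigin 3

/-- **F-0659, CLOSED INSTANCE (0 binders) at `p = 3`**: `DeltaYEllIsoTate (Ω_χ(3))` over `K₀ = ℚ₃`.
[cite: MochizukiEtTh2009, §1 p.238] -/
theorem deltaYEllIsoTate_chiBridgeOrigin_three :
    Literature.AnabelianGeometry.SemiGraphs.OncePuncturedTemperedGroup.DeltaYEllIsoTate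
      ({ IsOfGeometricOrigin := fun _ => True
         IsTateOrigin := fun D => D = (ThetaSetting.modelχ' 3).toOncePuncturedTemperedGroup
           (Classical.choose (exists_oncePuncturedData_galEquiv_eq 3))
         isOfGeometricOrigin_of_isTateOrigin := fun _ _ => trivial } : TemperedPiOrigin ↥(curveχ' 3).K) :=
  deltaYEllIsoTate_chiBridgeOrigin 3

end OncePuncturedTemperedGroup

end Literature.AnabelianGeometry.SemiGraphs

end
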